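import Literature.AnabelianGeometry.SemiGraphs.ArithLevelDataCptOfChart
import Literature.AnabelianGeometry.SemiGraphs.ArithDictionariesOfCosetTower
import Literature.AnabelianGeometry.SemiGraphs.ImmersionLiftUnique
import Literature.AnabelianGeometry.SemiGraphs.ArithLevelDataCptOfCosetTower
import Literature.AnabelianGeometry.SemiGraphs.ArithLevelDataCptOfChartC
import HarnessLib

/-!
# [SemiAnbd] Thm 5.4 producer T54-B at the coset tower, with the estrangement input for COMPACT subgroups
# (`ArithLevelDataCpt.ofCosetTowerC`; twin of `ArithLevelDataCptOfCosetTower.lean`, finding F-d029g3-1)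

Mochizuki, *Semi-graphs of anabelioids*, Publ. RIMS **42** (2006), §5 pp. 62–66, Thm 5.4 (i) p. 66
[cite: MochizukiSemiAnbd2006, Thm 5.4 (i), p. 66].

PACKAGING CONSTRUCTOR (seat abc-iut-w4-d029, T54-B capstone holder; twin of abc-iut-w4-d053's
`ArithLevelDataCpt.ofCosetTower`, p425422, untouched; its helper theorems `cosetGraph_isGraph`,
`cosetGraphTrans_isImmersion`, `finite_cosetGraph_vertex/branch` are REUSED by import): identical binders
and wiring EXCEPT that the estrangement consequence at the finite coset levels, `hnobpN`, is taken for
COMPACT subgroups `C ≤ π₁^temp(𝒢)` only — the shape abc-iut-L3-t11's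
`noFixedBranchPairSystem_of_isTotallyEstranged_cpt` produces (from the (β)-chain's `stabBranchPairCpt'` for
abc-iut-L3-t6's levels, transported along abc-iut-L3-d4's `levelCosetIso`); the all-subgroups form of p425422
is unproducible over a Galois-countability tower (`NoFixedBranchPairAllFormFaithful.lean`, finding
F-d029g3-1).  The capstone `ArithLevelDataCpt.ofCosetTowerC c h𝒢 hG R ι … hnobpN stabBranchPairAug` is the
object the (P-Q)/(P-A)/(P-K) producers and d040's umbrella-Cpt bind to.  A DEFINITION assembling binders;
nothing asserted; typed ≠ proved; no side taken on [IUTchIII] Cor 3.12.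
-/

namespace Literature.AnabelianGeometry.SemiGraphs

open CategoryTheory
open scoped Pointwise

universe u v w

namespace ProfiniteSemiGraph

variable {𝒢 : ProfiniteSemiGraph.{u}} (c : TemperedPiChart 𝒢)

/-- **Compact-form arithmetic level data AT THE COSET TOWER, with the estrangement input for COMPACT
subgroups only** (twin of `ArithLevelDataCpt.ofCosetTower`, finding F-d029g3-1: the binder `hnobpN` in
the producible shape of abc-iut-L3-t11's `noFixedBranchPairSystem_of_isTotallyEstranged_cpt`; routed through
`ArithLevelDataCpt.ofChartEdgeDataC`).  Original docstring: **The compact-form arithmetic level data of the chart-produced decomposition data, AT THE COSET-GRAPH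
TOWER** ([SemiAnbd] Thm 5.4 (i) p. 66 / p. 65 / proof of Thm 3.7 (iii) p. 41): `ArithLevelDataCpt.ofChartEdgeData`
instantiated with trees `P.cosetGraph (K j)`, arithmetic actions `P.arithAct hP (K j)`, transitions
`P.cosetGraphTrans`, finite levels `P.cosetGraph (L j)` (finite-index levels `L j ⊇ K j`, the
transition being the graph-covering, an immersion by `hfree`), and the TWO-SIDED dictionaries (I1)–(I3)
DISCHARGED from abc-iut-w4-d059's «T54-B-dict2» (`hfixN/hstabN/hedgeN/hedgeFixN_of_cosetTower`).
Binders: the presentation (`hP`, `hPH`, `hPM`), dict2's algebraic tower inputs `hHK`/`hMK`/`hlift`/`hliftE`,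
the level families (`K`, `L`, `hfree`), trees `hT`, open kernels `hKopen`, the printed hypothesis
`noSwitchBase`, `hnobpN` at the finite levels, and (AI4″) `stabBranchPairAug`.  Nothing asserted.
[cite: MochizukiSemiAnbd2006, Thm 5.4 (i), p. 66] -/
noncomputable def _root_.Literature.AnabelianGeometry.SemiGraphs.ArithLevelDataCpt.ofCosetTowerC
    (h𝒢 : 𝒢.Thm37Hypotheses) (hG : 𝒢.graph.IsGraph) [Finite 𝒢.graph.Vertex] [Finite 𝒢.graph.Branch]
    (R : ChartRepresentatives c)
    {E : Type w} [Group E] [TopologicalSpace E] {PA : Type v} [Group PA]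
    (ι : c.G →* E) (hι : Function.Injective ι) (hnorm : (ι.range).Normal)
    (aug : E →* PA) (baseAct : PA →* Aut 𝒢.graph)
    -- the subgroup presentation and its compatibility with the outer action (abc-iut-L3-d4)
    (P : SemiGraph.SubgroupPresentation 𝒢.graph c.G) {Φ : E →* MulAut c.G}
    (hP : P.IsArithCompatible Φ (baseAct.comp aug))
    (hιΦ : ∀ g : c.G, Φ (ι g) = MulAut.conj g) (hισ : ∀ g : c.G, (baseAct.comp aug) (ι g) = 1)
    (hPH : ∀ w, P.H w ∈ verticialSubgroups c w) (hPM : ∀ e, P.M e ∈ edgeLikeSubgroups c e)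
    (w₀ : 𝒢.graph.Vertex)
    -- the tree levels
    (K : ℕ → Subgroup c.G) [∀ j, (K j).Normal] (hK : ∀ ⦃i j : ℕ⦄, i ≤ j → K j ≤ K i)
    (hKst : ∀ (j : ℕ) (e : E) (x : c.G), x ∈ K j → Φ e x ∈ K j)
    (hT : ∀ j, (P.cosetGraph (K j)).IsTree)
    (hKopen : ∀ j, IsOpen ((P.arithAct hP (K j) (hKst j)).ker : Set E))
    -- Thm 5.4's printed frame hypothesis on the base
    (noSwitchBase : NoBranchSwitching 𝒢.graph.edgeOf
      (fun (a : PA) (b : 𝒢.graph.Branch) => (baseAct a).hom.branchMap b))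
    -- abc-iut-w4-d059's dict2 algebraic tower inputs (topological discharge: abc-iut-w4-d085 (P-K))
    (hHK : ∀ (w : 𝒢.graph.Vertex) (x : c.G), (∀ j, x ∈ (P.H w : Set c.G) * (K j : Set c.G)) → x ∈ P.H w)
    (hMK : ∀ (e : 𝒢.graph.Edge) (x : c.G), (∀ j, x ∈ (P.M e : Set c.G) * (K j : Set c.G)) → x ∈ P.M e)
    (hlift : ∀ (w : 𝒢.graph.Vertex) (y : ℕ → c.G),
      (∀ ⦃i j : ℕ⦄, i ≤ j →
        DoubleCoset.mk (P.H w) (K i) (y j) = DoubleCoset.mk (P.H w) (K i) (y i)) →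
      ∃ z : c.G, ∀ j, DoubleCoset.mk (P.H w) (K j) z = DoubleCoset.mk (P.H w) (K j) (y j))
    (hliftE : ∀ (j₁ : ℕ) (e : 𝒢.graph.Edge) (y : {j : ℕ // j₁ ≤ j} → c.G),
      (∀ ⦃i j : {j : ℕ // j₁ ≤ j}⦄, i.1 ≤ j.1 →
        DoubleCoset.mk (P.M e) (K i.1) (y j) = DoubleCoset.mk (P.M e) (K i.1) (y i)) →
      ∃ z : c.G, ∀ j, DoubleCoset.mk (P.M e) (K j.1) z = DoubleCoset.mk (P.M e) (K j.1) (y j))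
    -- the finite levels
    (L : ℕ → Subgroup c.G) [∀ j, (L j).Normal] [∀ j, Finite (c.G ⧸ L j)]
    (hL : ∀ ⦃i j : ℕ⦄, i ≤ j → L j ≤ L i)
    (hLst : ∀ (j : ℕ) (e : E) (x : c.G), x ∈ L j → Φ e x ∈ L j) (hKL : ∀ j, K j ≤ L j)
    (hfree : ∀ (j : ℕ) (w : 𝒢.graph.Vertex) (z x : c.G), x ∈ L j → z * x * z⁻¹ ∈ P.H w → x ∈ K j)
    -- the estrangement consequence at the finite levels (abc-iut-L3-t11's shape)
    (hnobpN : ∀ (C : Subgroup c.G), IsCompact (C : Set c.G) →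
      ∀ (j₀ : ℕ) (w : ∀ i : {i : ℕ // j₀ ≤ i}, (P.cosetGraph (L i.1)).Vertex)
      (β β' : ∀ i : {i : ℕ // j₀ ≤ i}, (P.cosetGraph (L i.1)).Branch),
      (∀ i, β i ≠ β' i ∧ (P.cosetGraph (L i.1)).abuts (β i) = some (w i) ∧
        (P.cosetGraph (L i.1)).abuts (β' i) = some (w i)) →
      (∀ ⦃i i' : {i : ℕ // j₀ ≤ i}⦄ (h : i.1 ≤ i'.1), (P.cosetGraphTrans (hL h)).vertexMap (w i') = w i ∧
        (P.cosetGraphTrans (hL h)).branchMap (β i') = β i ∧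
          (P.cosetGraphTrans (hL h)).branchMap (β' i') = β' i) →
      (∀ (i : {i : ℕ // j₀ ≤ i}) (γ : C), (P.arithAct hP (L i.1) (hLst i.1) (ι γ)).hom.vertexMap (w i) = w i ∧
        (P.arithAct hP (L i.1) (hLst i.1) (ι γ)).hom.branchMap (β i) = β i ∧
          (P.arithAct hP (L i.1) (hLst i.1) (ι γ)).hom.branchMap (β' i) = β' i) → C = ⊥)
    -- (AI4″) at the finite levels (abc-iut-w4-d059, producer)
    (stabBranchPairAug : ∀ (C : Subgroup E), IsCompact (C : Set E) →
      ∀ (j₀ : ℕ) (w : ∀ i : {i : ℕ // j₀ ≤ i}, (P.cosetGraph (L i.1)).Vertex)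
      (β β' : ∀ i : {i : ℕ // j₀ ≤ i}, (P.cosetGraph (L i.1)).Branch),
      (∀ i, β i ≠ β' i ∧ (P.cosetGraph (L i.1)).abuts (β i) = some (w i) ∧
        (P.cosetGraph (L i.1)).abuts (β' i) = some (w i)) →
      (∀ ⦃i i' : {i : ℕ // j₀ ≤ i}⦄ (h : i.1 ≤ i'.1), (P.cosetGraphTrans (hL h)).vertexMap (w i') = w i ∧
        (P.cosetGraphTrans (hL h)).branchMap (β i') = β i ∧
          (P.cosetGraphTrans (hL h)).branchMap (β' i') = β' i) →
      (∀ (i : {i : ℕ // j₀ ≤ i}) (g : E), g ∈ C →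
        (P.arithAct hP (L i.1) (hLst i.1) g).hom.vertexMap (w i) = w i ∧
        (P.arithAct hP (L i.1) (hLst i.1) g).hom.branchMap (β i) = β i ∧
          (P.arithAct hP (L i.1) (hLst i.1) g).hom.branchMap (β' i) = β' i) →
      ∃ (v : 𝒢.graph.Vertex) (b b' : 𝒢.graph.Branch) (a : PA) (h : E),
        (decompositionDataOfChart R ι).abut b = some v ∧ (decompositionDataOfChart R ι).abut b' = some v ∧
        h ∈ (decompositionDataOfChart R ι).vertGp v ∧ (b' ≠ b ∨ h ∉ (decompositionDataOfChart R ι).brGp b) ∧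
        C.map aug ≤ conjSubgroup a (((decompositionDataOfChart R ι).brGp b ⊓
          conjSubgroup h ((decompositionDataOfChart R ι).brGp b')).map aug)) :
    ArithLevelDataCpt 𝒢.graph (decompositionDataOfChart R ι) aug baseAct :=
  haveI : ∀ j, Finite (P.cosetGraph (L j)).Vertex := fun j => P.finite_cosetGraph_vertex (L j)
  haveI : ∀ j, Finite (P.cosetGraph (L j)).Branch := fun j => P.finite_cosetGraph_branch (L j)
  ArithLevelDataCpt.ofChartEdgeDataC h𝒢 hG R ι hι hnorm aug baseAct
    (tree := fun j => P.cosetGraph (K j)) (isTree := hT) (isGraph := fun j => P.cosetGraph_isGraph hG (K j))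
    (vertex := fun j => P.vMk (K j) w₀ 1) (proj := fun j => P.cosetGraphProj (K j))
    (act := fun j => P.arithAct hP (K j) (hKst j)) (isOpen_ker := hKopen)
    (act_proj := fun j g => P.arithAct_comp_proj hP (K j) (hKst j) g)
    (noSwitchBase := noSwitchBase)
    (trans := fun _ _ h => P.cosetGraphTrans (hK h))
    (trans_id := fun j => P.cosetGraphTrans_refl (K j))
    (trans_comp := fun _ _ _ hij hjk => P.cosetGraphTrans_comp (hK hjk) (hK hij))
    (trans_over := fun _ _ h => P.cosetGraphTrans_comp_proj (hK h))
    (trans_act := fun _ _ h g => P.arithAct_trans hP (hKst _) (hKst _) (hK h) g)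
    (hfixN := hfixN_of_cosetTower c P hP ι hιΦ hισ K hK hKst hPH hHK)
    (hstabN := hstabN_of_cosetTower c P hP ι hιΦ hισ K hK hKst hPH hHK hlift)
    (hedgeN := hedgeN_of_cosetTower c P hP ι hιΦ hισ K hK hKst hPM hMK hliftE)
    (hedgeFixN := hedgeFixN_of_cosetTower c P hP ι hιΦ hισ K hK hKst hPM hMK hT hG)
    (level := fun j => P.cosetGraph (L j))
    (quot := fun j => P.cosetGraphTrans (hKL j))
    (quot_isImmersion := fun j => P.cosetGraphTrans_isImmersion (hKL j) (hfree j))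
    (levelAct := fun j => P.arithAct hP (L j) (hLst j))
    (act_quot := fun j g => P.arithAct_trans hP (hKst j) (hLst j) (hKL j) g)
    (levelTrans := fun _ _ h => P.cosetGraphTrans (hL h))
    (levelTrans_id := fun j => P.cosetGraphTrans_refl (L j))
    (levelTrans_comp := fun _ _ _ hij hjk => P.cosetGraphTrans_comp (hL hjk) (hL hij))
    (levelTrans_act := fun _ _ h g => P.arithAct_trans hP (hLst _) (hLst _) (hL h) g)
    (trans_quot := fun _ _ h => by rw [P.cosetGraphTrans_comp, P.cosetGraphTrans_comp])
    (hnobpN := hnobpN) (stabBranchPairAug := stabBranchPairAug)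

end ProfiniteSemiGraph

end Literature.AnabelianGeometry.SemiGraphs
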